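import Mathlib
import Literature.MathematicalPhysics.QuantumLattice.HeisenbergOrderNeelRiemann3

/-!
# SoloBlind artefact 27 — the depth threshold of the Laguerre axis in the lattice model
(`paper/sharpest.md` §1 (xxv); claim C105; session s28 of the soloist `solo-RiemannHypothesis-blind`)

The first Laguerre inequality `L₁(f) = f'² - f f'' ≥ 0` (equivalently `(log|f|)'' ≤ 0`) holds on `ℝ` for every
`f` in the Laguerre–Pólya class.  The report asks how deep an off-line pair of zeros may sit before `L₁` stops
seeing it, in the lattice model
`f_b(t) = (t² + b²) · ∏_{k ≠ 0} (1 - t/(ks)) e^{t/(ks)}`  (real zeros `ks`, `k ∈ ℤ ∖ {0}`, plus the pair `±ib`).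
Since `-(log f_b)''(t) = 2(t² - b²)/(t² + b²)² + Σ_{k ≠ 0} (t - ks)⁻²` and, classically,
`Σ_{k ∈ ℤ} (t - ks)⁻² = (π/s)² / sin²(πt/s)`, the inequality `L₁(f_b)(t) ≥ 0` at a point `t ∉ sℤ` reads
`2(b² - t²)/(t² + b²)² + 1/t² ≤ (π/s)² / sin²(πt/s)`.
THEOREM (report, (xxv)): this holds for all such `t` iff `b ≥ (√6/π)·s` (in prose the 'only if' is the limit
`t → 0`: the right side minus `1/t²` tends to `π²/(3s²)` — Basel).  BOTH directions are kernel-checked here: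
* (input, already in the tree: the Taylor bound `sin x ≤ x - x³/6 + x⁵/120` for `x ≥ 0`,
  `Literature.MathematicalPhysics.QuantumLattice.KLSNumerics.sin_le_taylor_five`; and Mathlib's `Real.sin_ge_sub_cube`);
* `soloBlind_sin_sq_mul_le`: `sin²x · (3 + x²) ≤ 3x²` for every real `x` (slack `x⁶/15 + O(x⁸)` at `0`);
* `soloBlind_inv_sq_add_third_le`: `1/x² + 1/3 ≤ 1/sin²x` whenever `sin x ≠ 0`, and
  `soloBlind_third_optimal`: the constant `1/3` cannot be increased;
* `soloBlind_laguerreDepth`: for `0 < s`, `(√6/π)s ≤ b` and `sin(πt/s) ≠ 0`,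
  `2(b² - t²)/(t² + b²)² + 1/t² ≤ (π/s)²/sin²(πt/s)` — termwise: the pair term is `≤ 2/b² ≤ π²/(3s²)`.
* `soloBlind_laguerreDepth_sharp`: for `0 < b < (√6/π)s` there is an admissible `t` (near `0`) at which the
  inequality FAILS — the threshold is exact ('only if'; via `soloBlind_inv_sin_sq_le`: `1/sin²x ≤ 1/x² + 1/3 + 3x²/25`
  on `(0,1]`, and `soloBlind_pair_term_ge`: `2(b²-t²)/(t²+b²)² ≥ 2/b² - 6t²/b⁴ - 2t⁴/b⁶`).
What is NOT formalised: the partial-fraction identity for `π² csc²` and the product `f_b` itself (classical;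
the theorem is stated directly on the displayed rational/trigonometric inequality).  Mathlib + one tree lemma; no sorries.
-/

namespace Summit.RiemannHypothesis.RiemannHypothesis.Theorems

/-- The core inequality of the Laguerre-axis threshold: `sin²x · (3 + x²) ≤ 3x²` for every real `x`
(equality to order `x⁴` at `0`; the slack is `x⁶/15 + O(x⁸)`). -/
theorem soloBlind_sin_sq_mul_le (x : ℝ) : Real.sin x ^ 2 * (3 + x ^ 2) ≤ 3 * x ^ 2 := by
  rcases le_or_gt (3 / 2 : ℝ) (x ^ 2) with hbig | hsmall
  · calc Real.sin x ^ 2 * (3 + x ^ 2) ≤ 1 * (3 + x ^ 2) := by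
          gcongr
          exact Real.sin_sq_le_one x
      _ ≤ 3 * x ^ 2 := by linarith
  · wlog hx : 0 ≤ x generalizing x
    · have h' := this (-x) (by simpa using hsmall) (by linarith)
      simpa [Real.sin_neg] using h'
    have hxpi : x < Real.pi := by nlinarith [Real.pi_gt_three]
    have hs0 : 0 ≤ Real.sin x := Real.sin_nonneg_of_nonneg_of_le_pi hx hxpi.le
    have hs1 : Real.sin x ≤ x - x ^ 3 / 6 + x ^ 5 / 120 :=
      Literature.MathematicalPhysics.QuantumLattice.KLSNumerics.sin_le_taylor_five hx
    have hsq : Real.sin x ^ 2 ≤ (x - x ^ 3 / 6 + x ^ 5 / 120) ^ 2 := pow_le_pow_left₀ hs0 hs1 2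
    have hr : 0 ≤ 1 / 5 - 13 * x ^ 2 / 360 + 37 * x ^ 4 / 14400 - x ^ 6 / 14400 := by
      nlinarith [mul_nonneg (sq_nonneg (x ^ 2)) (sub_nonneg.2 hsmall.le), sq_nonneg (x ^ 2),
        sq_nonneg x]
    have hx6 : 0 ≤ x ^ 6 * (1 / 5 - 13 * x ^ 2 / 360 + 37 * x ^ 4 / 14400 - x ^ 6 / 14400) :=
      mul_nonneg (by positivity) hr
    calc Real.sin x ^ 2 * (3 + x ^ 2) ≤ (x - x ^ 3 / 6 + x ^ 5 / 120) ^ 2 * (3 + x ^ 2) := by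
          gcongr
      _ = 3 * x ^ 2 - x ^ 6 * (1 / 5 - 13 * x ^ 2 / 360 + 37 * x ^ 4 / 14400 - x ^ 6 / 14400) := by
          ring
      _ ≤ 3 * x ^ 2 := by linarith

/-- Reciprocal form: `1/x² + 1/3 ≤ 1/sin²x` whenever `sin x ≠ 0` — the termwise bound behind the
lattice part of the threshold (with `Σ_{k∈ℤ}(x - kπ)⁻² = 1/sin²x` it says `Σ_{k≠0}(x - kπ)⁻² ≥ 1/3 = Σ_{k≠0}(kπ)⁻²`). -/
theorem soloBlind_inv_sq_add_third_le {x : ℝ} (hx : Real.sin x ≠ 0) :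
    1 / x ^ 2 + 1 / 3 ≤ 1 / Real.sin x ^ 2 := by
  have hx0 : x ≠ 0 := by
    rintro rfl
    exact hx Real.sin_zero
  have hx2 : 0 < x ^ 2 := by positivity
  have hs2 : 0 < Real.sin x ^ 2 := by positivity
  rw [div_add_div _ _ hx2.ne' three_ne_zero, div_le_div_iff₀ (by positivity) hs2]
  have := soloBlind_sin_sq_mul_le x
  nlinarith [this]

/-- Optimality of the constant `1/3`: for every `c > 1/3` there is an `x` with `sin x ≠ 0` and
`1/sin²x < 1/x² + c` (so `(√6/π)s` in `soloBlind_laguerreDepth` cannot be lowered: letting `t → 0`). -/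
theorem soloBlind_third_optimal {c : ℝ} (hc : 1 / 3 < c) :
    ∃ x : ℝ, Real.sin x ≠ 0 ∧ 1 / Real.sin x ^ 2 < 1 / x ^ 2 + c := by
  have hc0 : 0 < c := by linarith
  set ε : ℝ := (c - 1 / 3) / (2 * c) with hε
  have hε0 : 0 < ε := by positivity
  have hε1 : ε < 1 := by
    rw [hε, div_lt_one (by positivity)]
    linarith
  set x : ℝ := min 1 ε with hxdef
  have hx0 : 0 < x := lt_min one_pos hε0
  have hx1 : x ≤ 1 := min_le_left _ _
  have hxε : x ≤ ε := min_le_right _ _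
  have hxx : x ^ 2 ≤ ε := by nlinarith
  have hxpi : x < Real.pi := by linarith [Real.pi_gt_three]
  have hsinpos : 0 < Real.sin x := Real.sin_pos_of_pos_of_lt_pi hx0 hxpi
  have hlow : x - x ^ 3 / 6 ≤ Real.sin x := Real.sin_ge_sub_cube hx0.le
  have hm0 : 0 < x - x ^ 3 / 6 := by nlinarith
  refine ⟨x, hsinpos.ne', ?_⟩
  have hx2 : 0 < x ^ 2 := by positivity
  have hs2 : 0 < Real.sin x ^ 2 := by positivity
  -- 1/sin² ≤ 1/(x - x³/6)² and the latter is < 1/x² + c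
  have hsq : (x - x ^ 3 / 6) ^ 2 ≤ Real.sin x ^ 2 := pow_le_pow_left₀ hm0.le hlow 2
  have step1 : 1 / Real.sin x ^ 2 ≤ 1 / (x - x ^ 3 / 6) ^ 2 :=
    one_div_le_one_div_of_le (by positivity) hsq
  have step2 : 1 / (x - x ^ 3 / 6) ^ 2 < 1 / x ^ 2 + c := by
    rw [div_add' _ _ _ hx2.ne', div_lt_div_iff₀ (by positivity) hx2]
    -- goal: 1 * x^2 < (1 + c * x^2) * (x - x^3/6)^2
    have key : (1 + c * x ^ 2) * (x - x ^ 3 / 6) ^ 2 - x ^ 2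
        = x ^ 2 * ((c - 1 / 3) * x ^ 2 + (1 / 36 - c / 3) * x ^ 4 + c / 36 * x ^ 6) := by ring
    have hpos : 0 < (c - 1 / 3) * x ^ 2 + (1 / 36 - c / 3) * x ^ 4 + c / 36 * x ^ 6 := by
      have h1 : c / 3 * x ^ 4 ≤ (c - 1 / 3) / 6 * x ^ 2 := by
        have : c / 3 * x ^ 2 ≤ (c - 1 / 3) / 6 := by
          have := mul_le_mul_of_nonneg_left hxx (le_of_lt (by positivity : (0:ℝ) < c / 3))
          rw [hε] at this
          have e : c / 3 * ((c - 1 / 3) / (2 * c)) = (c - 1 / 3) / 6 := by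
            field_simp
            ring
          linarith [this, e.le, e.ge]
        nlinarith [this, hx2]
      nlinarith [h1, hx2, pow_pos hx0 6, pow_pos hx0 4, hc0]
    nlinarith [key, hpos, hx2, mul_pos hx2 hpos]
  exact lt_of_le_of_lt step1 step2

/-- THE THRESHOLD ('if' direction of (xxv)): for `0 < s`, `b ≥ (√6/π)·s` and every `t` with `sin(πt/s) ≠ 0`,
`2(b² - t²)/(t² + b²)² + 1/t² ≤ (π/s)²/sin²(πt/s)`; i.e. (with the classical identity
`Σ_{k∈ℤ}(t - ks)⁻² = (π/s)²csc²(πt/s)`) the planted pair `±ib` among the lattice zeros `sℤ ∖ {0}` leaves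
`L₁(f_b) ≥ 0` everywhere once its depth is at least `(√6/π)·s ≈ 0.7797·s`. -/
theorem soloBlind_laguerreDepth (s b t : ℝ) (hs : 0 < s) (hb : Real.sqrt 6 / Real.pi * s ≤ b)
    (ht : Real.sin (Real.pi * t / s) ≠ 0) :
    2 * (b ^ 2 - t ^ 2) / (t ^ 2 + b ^ 2) ^ 2 + 1 / t ^ 2
      ≤ (Real.pi / s) ^ 2 / Real.sin (Real.pi * t / s) ^ 2 := by
  have hpi := Real.pi_pos
  have hpi0 : Real.pi ≠ 0 := Real.pi_ne_zero
  have hs0 : s ≠ 0 := hs.ne'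
  have hb0 : 0 < b := lt_of_lt_of_le (by positivity) hb
  have ht0 : t ≠ 0 := by
    rintro rfl
    simp at ht
  -- (i) the pair's own term is at most 2/b²
  have h1 : 2 * (b ^ 2 - t ^ 2) / (t ^ 2 + b ^ 2) ^ 2 ≤ 2 / b ^ 2 := by
    rw [div_le_div_iff₀ (by positivity) (by positivity)]
    nlinarith [sq_nonneg t, sq_nonneg b, mul_nonneg (sq_nonneg t) (sq_nonneg b),
      pow_nonneg (sq_nonneg t) 2]
  -- (ii) 2/b² ≤ π²/(3s²) from b ≥ (√6/π)s
  have h2 : 2 / b ^ 2 ≤ Real.pi ^ 2 / (3 * s ^ 2) := by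
    have h6 : Real.sqrt 6 ^ 2 = 6 := Real.sq_sqrt (by norm_num)
    have hsq : (Real.sqrt 6 / Real.pi * s) ^ 2 ≤ b ^ 2 := pow_le_pow_left₀ (by positivity) hb 2
    have e : (Real.sqrt 6 / Real.pi * s) ^ 2 = 6 * s ^ 2 / Real.pi ^ 2 := by
      rw [mul_pow, div_pow, h6]
      ring
    rw [e, div_le_iff₀ (by positivity)] at hsq
    rw [div_le_div_iff₀ (by positivity) (by positivity)]
    nlinarith [hsq]
  -- (iii) the lattice term: π²/(3s²) + 1/t² ≤ (π/s)²/sin²(πt/s)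
  have h3 : Real.pi ^ 2 / (3 * s ^ 2) + 1 / t ^ 2 ≤ (Real.pi / s) ^ 2 / Real.sin (Real.pi * t / s) ^ 2 := by
    have hcore := soloBlind_inv_sq_add_third_le ht
    have ex1 : Real.pi ^ 2 / (3 * s ^ 2) + 1 / t ^ 2
        = (Real.pi / s) ^ 2 * (1 / (Real.pi * t / s) ^ 2 + 1 / 3) := by
      field_simp
      ring
    have ex2 : (Real.pi / s) ^ 2 / Real.sin (Real.pi * t / s) ^ 2
        = (Real.pi / s) ^ 2 * (1 / Real.sin (Real.pi * t / s) ^ 2) := by ring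
    rw [ex1, ex2]
    exact mul_le_mul_of_nonneg_left hcore (by positivity)
  linarith [h1, h2, h3]

/-- Upper bound for `csc²` near `0`: for `0 < x ≤ 1`, `1/sin²x ≤ 1/x² + 1/3 + (3/25)·x²`
(from `sin x ≥ x - x³/6`). -/
theorem soloBlind_inv_sin_sq_le {x : ℝ} (hx0 : 0 < x) (hx1 : x ≤ 1) :
    1 / Real.sin x ^ 2 ≤ 1 / x ^ 2 + 1 / 3 + 3 / 25 * x ^ 2 := by
  have hxpi : x < Real.pi := by linarith [Real.pi_gt_three]
  have hsin : 0 < Real.sin x := Real.sin_pos_of_pos_of_lt_pi hx0 hxpi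
  have hlow : x - x ^ 3 / 6 ≤ Real.sin x := Real.sin_ge_sub_cube hx0.le
  have hx2 : x ^ 2 ≤ 1 := pow_le_one₀ hx0.le hx1
  have hx3 : x ^ 3 ≤ x := by
    have h := mul_le_mul_of_nonneg_left hx2 hx0.le
    calc x ^ 3 = x * x ^ 2 := by ring
      _ ≤ x * 1 := h
      _ = x := mul_one x
  have hm0 : 0 < x - x ^ 3 / 6 := by linarith
  have hsq : (x - x ^ 3 / 6) ^ 2 ≤ Real.sin x ^ 2 := pow_le_pow_left₀ hm0.le hlow 2
  have step1 : 1 / Real.sin x ^ 2 ≤ 1 / (x - x ^ 3 / 6) ^ 2 :=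
    one_div_le_one_div_of_le (by positivity) hsq
  have step2 : 1 / (x - x ^ 3 / 6) ^ 2 ≤ 1 / x ^ 2 + 1 / 3 + 3 / 25 * x ^ 2 := by
    rw [div_le_iff₀ (by positivity)]
    have e : (1 / x ^ 2 + 1 / 3 + 3 / 25 * x ^ 2) * (x - x ^ 3 / 6) ^ 2
        = 1 + x ^ 4 * ((99 - 83 * x ^ 2 + 9 * x ^ 4) / 2700) := by
      field_simp
      ring
    rw [e]
    have hq : 0 ≤ (99 - 83 * x ^ 2 + 9 * x ^ 4) / 2700 := by
      apply div_nonneg _ (by norm_num)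
      nlinarith [sq_nonneg (x ^ 2)]
    nlinarith [mul_nonneg (pow_nonneg hx0.le 4) hq]
  exact step1.trans step2

/-- Lower bound for the pair's own term near `t = 0`: `2/b² - 6t²/b⁴ - 2t⁴/b⁶ ≤ 2(b² - t²)/(t² + b²)²`. -/
theorem soloBlind_pair_term_ge {b : ℝ} (hb : 0 < b) (t : ℝ) :
    2 / b ^ 2 - 6 * t ^ 2 / b ^ 4 - 2 * t ^ 4 / b ^ 6 ≤ 2 * (b ^ 2 - t ^ 2) / (t ^ 2 + b ^ 2) ^ 2 := by
  have e : 2 / b ^ 2 - 6 * t ^ 2 / b ^ 4 - 2 * t ^ 4 / b ^ 6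
      = (2 * b ^ 4 - 6 * t ^ 2 * b ^ 2 - 2 * t ^ 4) / b ^ 6 := by
    field_simp
  rw [e, div_le_div_iff₀ (by positivity) (by positivity)]
  have h1 : 0 ≤ t ^ 4 * b ^ 4 := by positivity
  have h2 : 0 ≤ t ^ 6 * b ^ 2 := by positivity
  have h3 : 0 ≤ t ^ 8 := by positivity
  have key : 2 * (b ^ 2 - t ^ 2) * b ^ 6 - (2 * b ^ 4 - 6 * t ^ 2 * b ^ 2 - 2 * t ^ 4) * (t ^ 2 + b ^ 2) ^ 2
      = 12 * (t ^ 4 * b ^ 4) + 10 * (t ^ 6 * b ^ 2) + 2 * t ^ 8 := by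
    ring
  linarith [key, h1, h2, h3]

/-- SHARPNESS ('only if' direction of (xxv)): if `0 < b < (√6/π)·s` then the inequality of
`soloBlind_laguerreDepth` fails at some admissible `t` (near `0`), i.e. `L₁(f_b) < 0` somewhere:
the threshold `(√6/π)·s` is exact. -/
theorem soloBlind_laguerreDepth_sharp (s b : ℝ) (hs : 0 < s) (hb0 : 0 < b)
    (hb : b < Real.sqrt 6 / Real.pi * s) :
    ∃ t : ℝ, Real.sin (Real.pi * t / s) ≠ 0 ∧
      (Real.pi / s) ^ 2 / Real.sin (Real.pi * t / s) ^ 2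
        < 2 * (b ^ 2 - t ^ 2) / (t ^ 2 + b ^ 2) ^ 2 + 1 / t ^ 2 := by
  have hpi := Real.pi_pos
  have hpi0 : Real.pi ≠ 0 := Real.pi_ne_zero
  have hs0 : s ≠ 0 := hs.ne'
  -- the gap g = 2/b² - π²/(3s²) > 0
  have h6 : Real.sqrt 6 ^ 2 = 6 := Real.sq_sqrt (by norm_num)
  have hbsq : b ^ 2 < 6 * s ^ 2 / Real.pi ^ 2 := by
    have h := pow_lt_pow_left₀ hb hb0.le two_ne_zero
    have e : (Real.sqrt 6 / Real.pi * s) ^ 2 = 6 * s ^ 2 / Real.pi ^ 2 := by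
      rw [mul_pow, div_pow, h6]
      ring
    rwa [e] at h
  set g : ℝ := 2 / b ^ 2 - Real.pi ^ 2 / (3 * s ^ 2) with hg
  have hgpos : 0 < g := by
    rw [hg, sub_pos, div_lt_div_iff₀ (by positivity) (by positivity)]
    rw [lt_div_iff₀ (by positivity)] at hbsq
    nlinarith [hbsq]
  -- the error constant M and the choice of x
  set M : ℝ := 6 * s ^ 2 / (Real.pi ^ 2 * b ^ 4) + 2 * s ^ 4 / (Real.pi ^ 4 * b ^ 6)
    + 3 * Real.pi ^ 2 / (25 * s ^ 2) with hM
  have hMpos : 0 < M := by positivity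
  set x : ℝ := min 1 (g / (2 * M)) with hxdef
  have hx0 : 0 < x := lt_min one_pos (by positivity)
  have hx1 : x ≤ 1 := min_le_left _ _
  have hxg : x ≤ g / (2 * M) := min_le_right _ _
  have hxx : x ^ 2 ≤ g / (2 * M) := by nlinarith
  have hx2M : x ^ 2 * M ≤ g / 2 := by
    have h := mul_le_mul_of_nonneg_right hxx hMpos.le
    have e : g / (2 * M) * M = g / 2 := by
      field_simp
    linarith [h, e.le, e.ge]
  have hxpi : x < Real.pi := by linarith [Real.pi_gt_three]
  have hsin : 0 < Real.sin x := Real.sin_pos_of_pos_of_lt_pi hx0 hxpi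
  -- the point t = s x / π
  set t : ℝ := s * x / Real.pi with htdef
  have ex : Real.pi * t / s = x := by
    rw [htdef]
    field_simp
  have htpos : 0 < t := by positivity
  have ht2 : t ^ 2 = s ^ 2 * x ^ 2 / Real.pi ^ 2 := by
    rw [htdef]
    field_simp
  have h1t : 1 / t ^ 2 = (Real.pi / s) ^ 2 / x ^ 2 := by
    rw [htdef]
    field_simp
  refine ⟨t, by rw [ex]; exact hsin.ne', ?_⟩
  rw [ex]
  -- (1) the csc term from above
  have A := soloBlind_inv_sin_sq_le hx0 hx1
  have C1 : (Real.pi / s) ^ 2 / Real.sin x ^ 2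
      ≤ 1 / t ^ 2 + Real.pi ^ 2 / (3 * s ^ 2) + 3 * Real.pi ^ 2 * x ^ 2 / (25 * s ^ 2) := by
    have h := mul_le_mul_of_nonneg_left A (le_of_lt (by positivity : (0:ℝ) < (Real.pi / s) ^ 2))
    have e1 : (Real.pi / s) ^ 2 * (1 / Real.sin x ^ 2) = (Real.pi / s) ^ 2 / Real.sin x ^ 2 := by
      ring
    have e2 : (Real.pi / s) ^ 2 * (1 / x ^ 2 + 1 / 3 + 3 / 25 * x ^ 2)
        = 1 / t ^ 2 + Real.pi ^ 2 / (3 * s ^ 2) + 3 * Real.pi ^ 2 * x ^ 2 / (25 * s ^ 2) := by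
      rw [h1t]
      ring
    rw [e1, e2] at h
    exact h
  -- (2) the pair term from below
  have B := soloBlind_pair_term_ge hb0 t
  -- (3) the error terms are at most x² M ≤ g/2
  have hx2le : x ^ 2 ≤ 1 := pow_le_one₀ hx0.le hx1
  have hx4 : x ^ 4 ≤ x ^ 2 := by
    have h := mul_le_mul_of_nonneg_left hx2le (sq_nonneg x)
    calc x ^ 4 = x ^ 2 * x ^ 2 := by ring
      _ ≤ x ^ 2 * 1 := h
      _ = x ^ 2 := mul_one _
  have E : 6 * t ^ 2 / b ^ 4 + 2 * t ^ 4 / b ^ 6 + 3 * Real.pi ^ 2 * x ^ 2 / (25 * s ^ 2)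
      ≤ x ^ 2 * M := by
    have et4 : t ^ 4 = (t ^ 2) ^ 2 := by ring
    rw [et4, ht2, hM]
    have e1 : 6 * (s ^ 2 * x ^ 2 / Real.pi ^ 2) / b ^ 4 = x ^ 2 * (6 * s ^ 2 / (Real.pi ^ 2 * b ^ 4)) := by
      ring
    have e2 : 2 * (s ^ 2 * x ^ 2 / Real.pi ^ 2) ^ 2 / b ^ 6 = x ^ 4 * (2 * s ^ 4 / (Real.pi ^ 4 * b ^ 6)) := by
      ring
    have e3 : 3 * Real.pi ^ 2 * x ^ 2 / (25 * s ^ 2) = x ^ 2 * (3 * Real.pi ^ 2 / (25 * s ^ 2)) := by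
      ring
    rw [e1, e2, e3]
    have hmid : x ^ 4 * (2 * s ^ 4 / (Real.pi ^ 4 * b ^ 6)) ≤ x ^ 2 * (2 * s ^ 4 / (Real.pi ^ 4 * b ^ 6)) :=
      mul_le_mul_of_nonneg_right hx4 (by positivity)
    linarith [hmid]
  -- combine
  have hgdef : g = 2 / b ^ 2 - Real.pi ^ 2 / (3 * s ^ 2) := hg
  linarith [C1, B, E, hx2M, hgpos, hgdef]

end Summit.RiemannHypothesis.RiemannHypothesis.Theorems
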